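import Mathlib
import Summits.Ventures.PercRepro2.KPrimeRootLeaf
import Summits.Ventures.PercRepro2.KPrimeLeafExt

/-!
# Transport of the mass vectors to a leaf extension (blind cell PercRepro2, mine-c g42;
`conjectures/MINE-C.md` §51.4)

The ten-mass vector `kmasses` and the isolated vector `isoMasses` transport along a configuration
map carrying connectivity (`kmasses_transport'`, `isoMasses_transport'` — the vector forms of
`KPrimeCycle.kprimeForm_transport'`), hence from a graph to its leaf extension `leafExt ends z` at
old marks (`kmasses_leafExt`, `isoMasses_leafExt`, by `prob_comp_inl` and `conn_leafExt_iff`).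
With `kprime_of_rootLeaf_a₂` this makes the root-leaf case of a family computable on the family
itself: `(K′)` on `leafExt ends z` with `a₂` the leaf follows from `(K′)` on `ends` at `z` and
the three root-leaf coefficients `F₀, G₁, G₂` evaluated on `ends` (`kprime_leafExt_a₂`).
-/

namespace Summit.Ventures.PercRepro2

namespace KPrimeCycle

open Cycle

section Transport

variable {V : Type*} {V' : Type*} {E : Type*} {E' : Type*} [Fintype E] [DecidableEq E]
  [Fintype E'] [DecidableEq E'] [DecidableEq V] [DecidableEq V'] {R : Type*} [Field R]

/-- Transport of the ten-mass vector across types. -/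
theorem kmasses_transport' {q : E → R} {p : E' → R} {ends : E → Sym2 V}
    {ends' : E' → Sym2 V'} {Ψ : Config E' → Config E} {φ : V → V'}
    (hP : ∀ A : Set (Config E), prob q A = prob p (Ψ ⁻¹' A))
    (hH : ∀ ω x z, Conn ends (Ψ ω) x z ↔ Conn ends' ω (φ x) (φ z)) (a₁ a₂ b v y : V) :
    KPrime.kmasses ends a₁ a₂ b v y q =
      KPrime.kmasses ends' (φ a₁) (φ a₂) (φ b) (φ v) (φ y) p := by
  funext k
  fin_cases k <;>
  simp only [KPrime.kmasses, KPrime.cls01e, KPrime.cls01, KPrime.S, KPrime.Ω, KPrime.N, hP,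
    Set.preimage_inter, Set.preimage_union, Set.preimage_compl, preimage_connEvent' hH,
    preimage_avoidAll_singleton' hH, preimage_avoidAll_pair' hH]

omit [DecidableEq V] [DecidableEq V'] in
/-- Transport of the isolated mass vector across types. -/
theorem isoMasses_transport' {q : E → R} {p : E' → R} {ends : E → Sym2 V}
    {ends' : E' → Sym2 V'} {Ψ : Config E' → Config E} {φ : V → V'}
    (hP : ∀ A : Set (Config E), prob q A = prob p (Ψ ⁻¹' A))
    (hH : ∀ ω x z, Conn ends (Ψ ω) x z ↔ Conn ends' ω (φ x) (φ z)) (a₁ b v y : V) :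
    KPrime.isoMasses ends a₁ b v y q = KPrime.isoMasses ends' (φ a₁) (φ b) (φ v) (φ y) p := by
  funext k
  fin_cases k <;>
  simp only [KPrime.isoMasses, hP, Set.preimage_inter, Set.preimage_union, Set.preimage_compl,
    preimage_connEvent' hH]

end Transport

section LeafExt

variable {V : Type*} {E : Type*} [Fintype E] [DecidableEq E] [Fintype V] [DecidableEq V]
  {R : Type*} [Field R] [LinearOrder R] [IsStrictOrderedRing R]

omit [Fintype V] [LinearOrder R] [IsStrictOrderedRing R] in
/-- The ten-mass vector of the leaf extension at old marks is that of the old graph. -/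
theorem kmasses_leafExt (ends : E → Sym2 V) (z : V) (p : E ⊕ Unit → R) (a₁ a₂ b v y : V) :
    KPrime.kmasses (leafExt ends z) (Sum.inl a₁) (Sum.inl a₂) (Sum.inl b) (Sum.inl v) (Sum.inl y)
        p =
      KPrime.kmasses ends a₁ a₂ b v y (p ∘ Sum.inl) :=
  (kmasses_transport' (fun A => prob_comp_inl p A)
    (fun ω x x' => conn_leafExt_iff ends z ω x x') a₁ a₂ b v y).symm

omit [Fintype V] [DecidableEq V] [LinearOrder R] [IsStrictOrderedRing R] in
/-- The isolated mass vector of the leaf extension at old marks is that of the old graph. -/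
theorem isoMasses_leafExt (ends : E → Sym2 V) (z : V) (p : E ⊕ Unit → R) (a₁ b v y : V) :
    KPrime.isoMasses (leafExt ends z) (Sum.inl a₁) (Sum.inl b) (Sum.inl v) (Sum.inl y) p =
      KPrime.isoMasses ends a₁ b v y (p ∘ Sum.inl) :=
  (isoMasses_transport' (fun A => prob_comp_inl p A)
    (fun ω x x' => conn_leafExt_iff ends z ω x x') a₁ b v y).symm

omit [Fintype V] in
/-- **The root `a₂` on a leaf of `ends` at `z`**: `(K′)` on the leaf extension with `a₂` the leaf,
from `(K′)` on `ends` at `(a₁, z, b, v, y)` and the three root-leaf coefficients evaluated on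
`ends` with the old weights. -/
theorem kprime_leafExt_a₂ (ends : E → Sym2 V) (z a₁ b v y : V) (p : E ⊕ Unit → R)
    (hp : IsProbVec p) (he : p (Sum.inr ()) ≠ 1)
    (hF₀ : 0 ≤ KPrime.kformTri (KPrime.isoMasses ends a₁ b v y (p ∘ Sum.inl))
      (KPrime.isoMasses ends a₁ b v y (p ∘ Sum.inl)) (KPrime.isoMasses ends a₁ b v y (p ∘ Sum.inl)))
    (hG₁ : 0 ≤ KPrime.mixedOne (KPrime.isoMasses ends a₁ b v y (p ∘ Sum.inl))
      (KPrime.kmasses ends a₁ z b v y (p ∘ Sum.inl)))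
    (hG₂ : 0 ≤ KPrime.mixedTwo (KPrime.isoMasses ends a₁ b v y (p ∘ Sum.inl))
      (KPrime.kmasses ends a₁ z b v y (p ∘ Sum.inl)))
    (hF₁ : KPrime.KPrimeHolds ends a₁ z b v y (p ∘ Sum.inl)) :
    KPrime.KPrimeHolds (leafExt ends z) (Sum.inl a₁) (Sum.inr ()) (Sum.inl b) (Sum.inl v)
      (Sum.inl y) p := by
  refine KPrime.kprime_of_rootLeaf_a₂ hp (leafExt_leaf ends z) (by rw [leafExt_inr, Sym2.eq_swap])
    Sum.inl_ne_inr Sum.inl_ne_inr Sum.inl_ne_inr Sum.inl_ne_inr Sum.inl_ne_inr he ?_ ?_ ?_ ?_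
  · rwa [isoMasses_leafExt, update_inr_comp_inl]
  · rwa [isoMasses_leafExt, kmasses_leafExt, update_inr_comp_inl]
  · rwa [isoMasses_leafExt, kmasses_leafExt, update_inr_comp_inl]
  · rwa [← kprimeHolds_leafExt, update_inr_comp_inl]

end LeafExt

end KPrimeCycle

end Summit.Ventures.PercRepro2
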